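import Literature.Analysis.ValidatedNumerics.TaylorModelIntegralCert2DLogWeighted
import Literature.Analysis.ValidatedNumerics.TaylorModelIntegralCert3DTrig
import HarnessLib

/-!
# Triple-integral certificates with algebraic–logarithmic face weights (interval moments on 3-D kd-trees)

Trunk T-ANA (Analysis/ValidatedNumerics); namespace `Literature.Analysis.ValidatedNumerics.PolyMP`.
Sequel of `TaylorModelIntegralCert2DLogWeighted.lean` (product integration against real moments `wsumR` /
`wsum2R` / `weighted_boxR`; the interval pairing `wsumI` / `wsumIM` / `wsum2I`; the interval moments of the
algebraic–logarithmic edge factors `edgeMomL`, the direction weights `dirWL`, their moments `dirMomL` /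
`dirMomL_sound` and plans `dirPlanL`; the splits `algLogW_left_split` / `algLogW_right_split`), of
`TaylorModelIntegralCert2DWeighted.lean` (the code-list factor `facR`, the cut heuristic `cutW`), of
`TaylorModelIntegralCert3DAdaptive.lean` (3-D boxes `Box3Q`, kd-trees `KdTree3`, the final obligation `treeCheckG3`)
and of `TaylorModelIntegralCert3DTrig.lean` (the code lists `BExpr3T` in three variables with their box Taylor models
`BExpr3T.model` / `tmem3_model`).  Subject: kernel certificates
`lo ≤ ∫_{x0}^{x1} ∫_{y0}^{y1} ∫_{z0}^{z1} w(x, y, z) F(x, y, z) dz dy dx ≤ hi` for the ALGEBRAIC–LOGARITHMIC FACE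
WEIGHT `w = Π_{faces f} d_f^{α_f} (−log d_f)^{κ_f}` of the root box (`d_f` the distance to the face `f`, `α_f`
rational and `> −1` where singular, `κ_f ∈ ℕ`) — the end-point singular weights of product integration
(op. cit. Sect. 2.12.5: "a fixed function with a singularity … but such that `∫_0^1 w(x) x^k dx` exists";
Sect. 2.12.6: the Jacobi weight (2.12.6.2) and the logarithmic weights) in THREE variables, as the tensor weight of a
product rule over the cube (op. cit. Sect. 5.6: product rules for the cube are products of one-dimensional rules,
the weight factorising), on kd-trees.  Berz–Makino's verified quadrature is high-dimensional by design (the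
polynomial part of a multivariate Taylor model integrated exactly over each box of a partition, the remainder bound
times the measure of the box); here the exact integration is against the face weight, through its moments.

* **Part 0 — 3-D kd-tree certificates GENERIC IN THE LEAF RULE** `Λ : Box3Q → EPrm → MI × Bool`: the invariant
  `BoxClaim3R` (membership, integrability of the two iterated inner integrals and of every section, orientation),
  `tree3_sound_rule` (structural induction: `x`-splits by additivity over adjacent intervals, `y`-splits on every
  `x`-section, `z`-splits on every `(x, y)`-section), the obligations `leafCheck3R` and
  `integral_bounds_of_leafCheck3R`;
* **Part 1 — product integration against real moments in three variables** (`wsum3R`,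
  `integral_weight_mul_evalR3R`, `integral_weight_mul_evalR2_rows`, `integral3_weight_evalR3R`) and the weighted
  box estimate `weighted_box3R`: `|∫∫∫ WX WY WZ g − wsum3R μ ν ξ p| · S ≤ tabs3 (P − p) · μ₀ · ν₀ · ξ₀` with the
  three integrability facts (parametric integrals measurable by Fubini–Tonelli);
* **Part 2 — the interval pairing** `wsum3I` of rational rows with interval moments in three variables
  (`mem_wsum3I`);
* **Part 3 — the leaf rule `leafEnclWL3`** over the root box `R` (weight descriptor `WLPrm3`: six exponents, six
  logarithmic powers, the moment scale `T` and the log-series budget `KL`): per direction the plan `dirPlanL` and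
  the moments `dirMomL` of the bivariate module, the factors left to the Taylor model entering the code list as
  `exp (α log d) · (−log d)^κ` (`withPow3`, `withLogPow3`, `gexprL3`), the rational midpoint rows of the trivariate
  model paired in interval arithmetic with the three moment sequences, rescaled to `S` and widened by
  `⌈tabs3 · μ̄₀ · ν̄₀ · ξ̄₀⌉`; soundness `leafEnclWL3_sound : BoxClaim3R S (wfunL3 ω R F) B _`;
* **Part 4 — the certificate** `leafCheckWL3` / `treeCheckWL3` / `integral_bounds_of_leafCheckWL3` (hypothesis-free
  real inequalities once the Boolean obligations hold, one `decide` per leaf) and the refinement heuristic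
  `kdRefineWL3` (cuts by `cutW`).

Deliberately NOT here: leaves whose moments would carry both face factors of one direction (rejected and split),
a logarithmic factor of indefinite sign in the moments (odd `κ` beyond distance `1`: rejected, as in the bivariate
module), edge / vertex / interior point singularities not of tensor form (Duffy-type substitutions), dimension `≥ 4`.
Problem-independent; no facts, no axioms; all certificate data computable over `ℚ` and `ℤ`.

## References

* P. J. Davis, P. Rabinowitz, *Methods of Numerical Integration*, 2nd ed., Academic Press (1984): Sect. 2.5.6 (product
  integration: the approximation of the regular factor is integrated exactly against the weight through its
  moments), Sect. 2.12.4 (away from the singularity the weight is an ordinary smooth factor), Sect. 2.12.5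
  (product formulas for a weight singular at an end point all of whose moments exist), Sect. 2.12.6 (Gauss-type
  formulas for singular nonnegative weights; the Jacobi and logarithmic weights), Sect. 5.6 (product rules over the
  cube as products of one-dimensional rules). [cite: DavisRabinowitz1984, Sect. 2.5.6]
  [cite: DavisRabinowitz1984, Sect. 2.12.4] [cite: DavisRabinowitz1984, Sect. 2.12.5] [cite: DavisRabinowitz1984, Sect. 2.12.6]
  [cite: DavisRabinowitz1984, Sect. 5.6]
* I. S. Gradshteyn, I. M. Ryzhik, *Table of Integrals, Series, and Products*, 8th ed. (2015): 2.721 1 (the recurrence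
  for `∫ x^n ln^m x dx` behind the interval moments). [cite: GradshteynRyzhik2015, 2.721 1]
* K. Makino, M. Berz, *Taylor models and other validated functional inclusion methods*, Int. J. Pure Appl. Math. 4
  (2003) 379–456, Algorithm 2 (quadrature with Taylor models: exact integration of the polynomial part, the remainder
  bound times the measure). [cite: MakinoBerz2003, Algorithm 2]
* M. Berz, K. Makino, *New methods for high-dimensional verified quadrature*, Reliable Computing 5 (1999) 13–22,
  Sect. 2 (multivariate Taylor models over a partition of the domain box). [cite: BerzMakino1999, Sect. 2]
* A. Mahboubi, G. Melquiond, T. Sibut-Pinote, *Formally verified approximations of definite integrals*, ITP 2016,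
  LNCS 9807, 274–289, Sect. 3.3 (adaptive splitting of the domain; enclosures of the pieces added and checked by
  computation). [cite: MahboubiMelquiondSibutpinote2016, Sect. 3.3]
* Measurability of parametric integrals (Fubini–Tonelli; Mathlib `MeasureTheory.StronglyMeasurable.integral_prod_right`)
  and the translation of an interval integral (Mathlib `intervalIntegral.integral_comp_add_left`). [folklore]
-/

open MeasureTheory intervalIntegral Set
open scoped Interval

namespace Literature.Analysis.ValidatedNumerics

namespace PolyMP

open Literature.Analysis.ValidatedNumerics.NumericsMP
open Literature.Analysis.ValidatedNumerics.ExpPoly (Poly)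
open Literature.Analysis.ValidatedNumerics.ExpPoly
open Literature.Analysis.ValidatedNumerics.TaylorForm

/-! ### Part 0. 3-D kd-tree certificates generic in the LEAF RULE -/

/-- **What a sound (scaled) enclosure `J` of `∫_{x0}^{x1} ∫_{y0}^{y1} ∫_{z0}^{z1} f` provides downstream**: membership,
integrability of the iterated inner integral on `[x0, x1]`, of the innermost integral on `[y0, y1]` for every
`x ∈ [x0, x1]`, of every section `z ↦ f x y z`, and the orientation of the box (the induction invariant of the tree of
sub-boxes, op. cit. Sect. 3.3). [cite: MahboubiMelquiondSibutpinote2016, Sect. 3.3] -/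
def BoxClaim3R (S : ℕ) (f : ℝ → ℝ → ℝ → ℝ) (B : Box3Q) (J : MI) : Prop :=
  MI.mem S (∫ x in (B.x0 : ℝ)..B.x1, ∫ y in (B.y0 : ℝ)..B.y1, ∫ z in (B.z0 : ℝ)..B.z1, f x y z) J ∧
    IntervalIntegrable (fun x => ∫ y in (B.y0 : ℝ)..B.y1, ∫ z in (B.z0 : ℝ)..B.z1, f x y z) volume (B.x0 : ℝ) B.x1 ∧
    (∀ x : ℝ, (B.x0 : ℝ) ≤ x → x ≤ B.x1 →
      IntervalIntegrable (fun y => ∫ z in (B.z0 : ℝ)..B.z1, f x y z) volume (B.y0 : ℝ) B.y1) ∧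
    (∀ x y : ℝ, (B.x0 : ℝ) ≤ x → x ≤ B.x1 → (B.y0 : ℝ) ≤ y → y ≤ B.y1 →
      IntervalIntegrable (fun z => f x y z) volume (B.z0 : ℝ) B.z1) ∧
    B.x0 ≤ B.x1 ∧ B.y0 ≤ B.y1 ∧ B.z0 ≤ B.z1

/-- Every leaf accepted by the leaf rule `Λ` and inside its claim. [cite: MahboubiMelquiondSibutpinote2016, Sect. 3.3] -/
def leafClaimsOK3R (Λ : Box3Q → EPrm → MI × Bool) (ls : List (Box3Q × EPrm × MI)) : Bool :=
  ls.all fun l =>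
    let e := Λ l.1 l.2.1
    e.2 && decide (l.2.2.lo ≤ e.1.lo) && decide (e.1.hi ≤ l.2.2.hi)

/-- **Soundness of a checked 3-D tree for an ARBITRARY sound leaf rule** (structural induction: a leaf by the rule's
soundness and monotonicity of membership; an `x`-split by additivity over adjacent intervals; a `y`-split by
additivity on every `x`-section; a `z`-split by additivity on every `(x, y)`-section, pushed through both outer
integrals by `integral_congr`). [cite: MahboubiMelquiondSibutpinote2016, Sect. 3.3] -/
theorem tree3_sound_rule {S : ℕ} {f : ℝ → ℝ → ℝ → ℝ} {Λ : Box3Q → EPrm → MI × Bool}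
    (hΛ : ∀ (B : Box3Q) (P : EPrm), (Λ B P).2 = true → BoxClaim3R S f B (Λ B P).1) :
    ∀ (t : KdTree3) (B : Box3Q), leafClaimsOK3R Λ (t.leaves B) = true → BoxClaim3R S f B t.total
  | KdTree3.leaf P J, B, hok => by
      simp only [KdTree3.leaves, leafClaimsOK3R, List.all_cons, List.all_nil, Bool.and_true, Bool.and_eq_true,
        decide_eq_true_eq] at hok
      obtain ⟨⟨hacc, hlo⟩, hhi⟩ := hok
      obtain ⟨hm, hI, hσ, hτ, hx, hy, hz⟩ := hΛ B P hacc
      refine ⟨⟨?_, ?_⟩, hI, hσ, hτ, hx, hy, hz⟩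
      · exact le_trans (by exact_mod_cast hlo) hm.1
      · exact le_trans hm.2 (by exact_mod_cast hhi)
  | KdTree3.splitX c L R, B, hok => by
      simp only [KdTree3.leaves, leafClaimsOK3R, List.all_append, Bool.and_eq_true] at hok
      obtain ⟨hmL, hIL, hσL, hτL, hxL, hyL, hzL⟩ :=
        tree3_sound_rule hΛ L ⟨B.x0, c, B.y0, B.y1, B.z0, B.z1⟩ (by simpa [leafClaimsOK3R] using hok.1)
      obtain ⟨hmR, hIR, hσR, hτR, hxR, hyR, hzR⟩ :=
        tree3_sound_rule hΛ R ⟨c, B.x1, B.y0, B.y1, B.z0, B.z1⟩ (by simpa [leafClaimsOK3R] using hok.2)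
      simp only at hmL hIL hσL hτL hxL hyL hzL hmR hIR hσR hτR hxR hyR hzR
      refine ⟨?_, hIL.trans hIR, ?_, ?_, hxL.trans hxR, hyL, hzL⟩
      · rw [KdTree3.total, ← intervalIntegral.integral_add_adjacent_intervals hIL hIR]
        exact MI.mem_add hmL hmR
      · intro x h0 h1
        rcases le_total x (c : ℝ) with hc | hc
        · exact hσL x h0 hc
        · exact hσR x hc h1
      · intro x y h0 h1 g0 g1
        rcases le_total x (c : ℝ) with hc | hc
        · exact hτL x y h0 hc g0 g1
        · exact hτR x y hc h1 g0 g1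
  | KdTree3.splitY c L R, B, hok => by
      simp only [KdTree3.leaves, leafClaimsOK3R, List.all_append, Bool.and_eq_true] at hok
      obtain ⟨hmL, hIL, hσL, hτL, hxL, hyL, hzL⟩ :=
        tree3_sound_rule hΛ L ⟨B.x0, B.x1, B.y0, c, B.z0, B.z1⟩ (by simpa [leafClaimsOK3R] using hok.1)
      obtain ⟨hmR, hIR, hσR, hτR, hxR, hyR, hzR⟩ :=
        tree3_sound_rule hΛ R ⟨B.x0, B.x1, c, B.y1, B.z0, B.z1⟩ (by simpa [leafClaimsOK3R] using hok.2)
      simp only at hmL hIL hσL hτL hxL hyL hzL hmR hIR hσR hτR hxR hyR hzR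
      have hxx : (B.x0 : ℝ) ≤ B.x1 := by exact_mod_cast hxL
      have hsec : ∀ x : ℝ, (B.x0 : ℝ) ≤ x → x ≤ B.x1 →
          (∫ y in (B.y0 : ℝ)..c, ∫ z in (B.z0 : ℝ)..B.z1, f x y z) +
              ∫ y in (c : ℝ)..B.y1, ∫ z in (B.z0 : ℝ)..B.z1, f x y z =
            ∫ y in (B.y0 : ℝ)..B.y1, ∫ z in (B.z0 : ℝ)..B.z1, f x y z :=
        fun x h0 h1 => intervalIntegral.integral_add_adjacent_intervals (hσL x h0 h1) (hσR x h0 h1)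
      have heqOn : EqOn (fun x => (∫ y in (B.y0 : ℝ)..c, ∫ z in (B.z0 : ℝ)..B.z1, f x y z) +
            ∫ y in (c : ℝ)..B.y1, ∫ z in (B.z0 : ℝ)..B.z1, f x y z)
          (fun x => ∫ y in (B.y0 : ℝ)..B.y1, ∫ z in (B.z0 : ℝ)..B.z1, f x y z) (uIcc (B.x0 : ℝ) B.x1) := by
        intro x hx
        rw [uIcc_of_le hxx] at hx
        exact hsec x hx.1 hx.2
      refine ⟨?_, ?_, fun x h0 h1 => (hσL x h0 h1).trans (hσR x h0 h1), ?_, hxL, hyL.trans hyR, hzL⟩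
      · rw [KdTree3.total, ← intervalIntegral.integral_congr heqOn, intervalIntegral.integral_add hIL hIR]
        exact MI.mem_add hmL hmR
      · exact (hIL.add hIR).congr fun x hx => heqOn (uIoc_subset_uIcc hx)
      · intro x y h0 h1 g0 g1
        rcases le_total y (c : ℝ) with hc | hc
        · exact hτL x y h0 h1 g0 hc
        · exact hτR x y h0 h1 hc g1
  | KdTree3.splitZ c L R, B, hok => by
      simp only [KdTree3.leaves, leafClaimsOK3R, List.all_append, Bool.and_eq_true] at hok
      obtain ⟨hmL, hIL, hσL, hτL, hxL, hyL, hzL⟩ :=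
        tree3_sound_rule hΛ L ⟨B.x0, B.x1, B.y0, B.y1, B.z0, c⟩ (by simpa [leafClaimsOK3R] using hok.1)
      obtain ⟨hmR, hIR, hσR, hτR, hxR, hyR, hzR⟩ :=
        tree3_sound_rule hΛ R ⟨B.x0, B.x1, B.y0, B.y1, c, B.z1⟩ (by simpa [leafClaimsOK3R] using hok.2)
      simp only at hmL hIL hσL hτL hxL hyL hzL hmR hIR hσR hτR hxR hyR hzR
      have hxx : (B.x0 : ℝ) ≤ B.x1 := by exact_mod_cast hxL
      have hyy : (B.y0 : ℝ) ≤ B.y1 := by exact_mod_cast hyL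
      have hin : ∀ x y : ℝ, (B.x0 : ℝ) ≤ x → x ≤ B.x1 → (B.y0 : ℝ) ≤ y → y ≤ B.y1 →
          (∫ z in (B.z0 : ℝ)..c, f x y z) + ∫ z in (c : ℝ)..B.z1, f x y z = ∫ z in (B.z0 : ℝ)..B.z1, f x y z :=
        fun x y h0 h1 g0 g1 =>
          intervalIntegral.integral_add_adjacent_intervals (hτL x y h0 h1 g0 g1) (hτR x y h0 h1 g0 g1)
      have hmidOn : ∀ x : ℝ, (B.x0 : ℝ) ≤ x → x ≤ B.x1 →
          EqOn (fun y => (∫ z in (B.z0 : ℝ)..c, f x y z) + ∫ z in (c : ℝ)..B.z1, f x y z)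
            (fun y => ∫ z in (B.z0 : ℝ)..B.z1, f x y z) (uIcc (B.y0 : ℝ) B.y1) := by
        intro x h0 h1 y hy
        rw [uIcc_of_le hyy] at hy
        exact hin x y h0 h1 hy.1 hy.2
      have hmid : ∀ x : ℝ, (B.x0 : ℝ) ≤ x → x ≤ B.x1 →
          (∫ y in (B.y0 : ℝ)..B.y1, ∫ z in (B.z0 : ℝ)..c, f x y z) +
              ∫ y in (B.y0 : ℝ)..B.y1, ∫ z in (c : ℝ)..B.z1, f x y z =
            ∫ y in (B.y0 : ℝ)..B.y1, ∫ z in (B.z0 : ℝ)..B.z1, f x y z := by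
        intro x h0 h1
        rw [← intervalIntegral.integral_add (hσL x h0 h1) (hσR x h0 h1)]
        exact intervalIntegral.integral_congr (hmidOn x h0 h1)
      have heqOn : EqOn (fun x => (∫ y in (B.y0 : ℝ)..B.y1, ∫ z in (B.z0 : ℝ)..c, f x y z) +
            ∫ y in (B.y0 : ℝ)..B.y1, ∫ z in (c : ℝ)..B.z1, f x y z)
          (fun x => ∫ y in (B.y0 : ℝ)..B.y1, ∫ z in (B.z0 : ℝ)..B.z1, f x y z) (uIcc (B.x0 : ℝ) B.x1) := by
        intro x hx
        rw [uIcc_of_le hxx] at hx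
        exact hmid x hx.1 hx.2
      refine ⟨?_, ?_, ?_, fun x y h0 h1 g0 g1 => (hτL x y h0 h1 g0 g1).trans (hτR x y h0 h1 g0 g1),
        hxL, hyL, hzL.trans hzR⟩
      · rw [KdTree3.total, ← intervalIntegral.integral_congr heqOn, intervalIntegral.integral_add hIL hIR]
        exact MI.mem_add hmL hmR
      · exact (hIL.add hIR).congr fun x hx => heqOn (uIoc_subset_uIcc hx)
      · intro x h0 h1
        exact ((hσL x h0 h1).add (hσR x h0 h1)).congr fun y hy => hmidOn x h0 h1 (uIoc_subset_uIcc hy)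

/-- **Kernel obligation for leaf `i` under the leaf rule `Λ`** (3-D): leaf `i` of the tree over `B` is accepted by `Λ`
and its enclosure lies inside its claim; vacuously `true` past the last leaf.
[cite: MahboubiMelquiondSibutpinote2016, Sect. 3.3] -/
def leafCheck3R (Λ : Box3Q → EPrm → MI × Bool) (t : KdTree3) (B : Box3Q) (i : ℕ) : Bool :=
  match (t.leaves B)[i]? with
  | none => true
  | some l =>
      let e := Λ l.1 l.2.1
      e.2 && decide (l.2.2.lo ≤ e.1.lo) && decide (e.1.hi ≤ l.2.2.hi)

/-- [folklore] -/
private theorem leafClaimsOK3R_of_leafCheck3R (Λ : Box3Q → EPrm → MI × Bool) (t : KdTree3) (B : Box3Q) {n : ℕ}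
    (hn : t.size ≤ n) (H : ∀ i : ℕ, i < n → leafCheck3R Λ t B i = true) : leafClaimsOK3R Λ (t.leaves B) = true := by
  unfold leafClaimsOK3R
  refine List.all_eq_true.2 fun l hl => ?_
  obtain ⟨i, hi, rfl⟩ := List.getElem_of_mem hl
  have hlt : i < n := lt_of_lt_of_le (by simpa [KdTree3.length_leaves] using hi) hn
  have := H i hlt
  simp only [leafCheck3R, List.getElem?_eq_getElem hi] at this
  exact this

/-- **Soundness of the adaptive 3-D certificate for an arbitrary leaf rule**: if `Λ` is sound for `f` (given `0 < S`),
every leaf obligation holds and the final obligation `treeCheckG3` holds, then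
`lo ≤ ∫_{x0}^{x1} ∫_{y0}^{y1} ∫_{z0}^{z1} f ≤ hi`. [cite: MahboubiMelquiondSibutpinote2016, Sect. 3.3] -/
theorem integral_bounds_of_leafCheck3R {S : ℕ} {f : ℝ → ℝ → ℝ → ℝ} {Λ : Box3Q → EPrm → MI × Bool}
    (hΛ : 0 < S → ∀ (B : Box3Q) (P : EPrm), (Λ B P).2 = true → BoxClaim3R S f B (Λ B P).1)
    {t : KdTree3} {B : Box3Q} {n : ℕ} {lo hi : ℚ} (hleaf : ∀ i : ℕ, i < n → leafCheck3R Λ t B i = true)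
    (ht : treeCheckG3 S t n lo hi = true) :
    (lo : ℝ) ≤ ∫ x in (B.x0 : ℝ)..B.x1, ∫ y in (B.y0 : ℝ)..B.y1, ∫ z in (B.z0 : ℝ)..B.z1, f x y z ∧
      ∫ x in (B.x0 : ℝ)..B.x1, ∫ y in (B.y0 : ℝ)..B.y1, ∫ z in (B.z0 : ℝ)..B.z1, f x y z ≤ (hi : ℝ) := by
  unfold treeCheckG3 at ht
  simp only [Bool.and_eq_true, decide_eq_true_eq] at ht
  obtain ⟨⟨⟨hS, hn⟩, hlo⟩, hhi⟩ := ht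
  obtain ⟨⟨h1, h2⟩, -⟩ := tree3_sound_rule (hΛ hS) t B (leafClaimsOK3R_of_leafCheck3R Λ t B hn hleaf)
  have hSr : (0 : ℝ) < S := by exact_mod_cast hS
  have hloR : (lo : ℝ) * S ≤ (t.total.lo : ℝ) := by exact_mod_cast hlo
  have hhiR : (t.total.hi : ℝ) ≤ (hi : ℝ) * S := by exact_mod_cast hhi
  exact ⟨le_of_mul_le_mul_right (hloR.trans h1) hSr, le_of_mul_le_mul_right (h2.trans hhiR) hSr⟩

/-! ### Part 1. Product integration against real moments in three variables; the weighted box estimate -/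

/-- The weighted triple integral of rational rows against real moments: `Σ_i μ_i Σ_j ν_j Σ_m ξ_m q_ijm`
(the modified moments of product integration, one variable at a time). [cite: DavisRabinowitz1984, Sect. 2.5.6] -/
noncomputable def wsum3R (μ ν ξ : ℕ → ℝ) (p : List (List Poly)) : ℝ :=
  wsumR μ (p.map fun q => wsum2R ν ξ q) 0

/-- [folklore] -/
private theorem continuous_evalR_rowWL3 (as : List ℝ) : Continuous (evalR as) :=
  continuous_iff_continuousAt.2 fun x => (hasDerivAt_evalR as x).continuousAt

/-- [folklore] -/
private theorem continuous_evalR2_sndWL3 : ∀ (p : List (List ℝ)) (ρ : ℝ), Continuous fun σ => evalR2 p ρ σ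
  | [], _ => by simpa using continuous_const
  | r :: rs, ρ => by
      simp only [evalR2_cons]
      exact (continuous_evalR_rowWL3 r).add (continuous_const.mul (continuous_evalR2_sndWL3 rs ρ))

/-- [folklore] -/
private theorem continuous_evalR3_thdWL3 :
    ∀ (p : List (List (List ℝ))) (ρ σ : ℝ), Continuous fun τ => evalR3 p ρ σ τ
  | [], _, _ => by simpa using continuous_const
  | r :: rs, ρ, σ => by
      simp only [evalR3_cons]
      exact (continuous_evalR2_sndWL3 r σ).add (continuous_const.mul (continuous_evalR3_thdWL3 rs ρ σ))

/-- **Product integration of the rows of a REAL bivariate array against real moments** (inner variable):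
`∫_{-k}^{k} W(v) · Σ_i uⁱ r_i(v) dv = Σ_i uⁱ · wsumR ν r_i 0`. [cite: DavisRabinowitz1984, Sect. 2.5.6] -/
theorem integral_weight_mul_evalR2_rows {W : ℝ → ℝ} {k : ℚ} (hW : IntervalIntegrable W volume (-(k : ℝ)) k)
    {ν : ℕ → ℝ} (hν : ∀ j : ℕ, ∫ v in (-(k : ℝ))..k, W v * v ^ j = ν j) (u : ℝ) :
    ∀ P : List (List ℝ), ∫ v in (-(k : ℝ))..k, W v * evalR2 P u v = evalR (P.map fun r => wsumR ν r 0) u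
  | [] => by simp
  | r :: rs => by
      simp only [List.map_cons, evalR2_cons, evalR_cons]
      have hpt : ∀ v : ℝ, W v * (evalR r v + u * evalR2 rs u v) =
          W v * v ^ 0 * evalR r v + u * (W v * evalR2 rs u v) := by
        intro v; rw [pow_zero, mul_one]; ring
      have h1 : IntervalIntegrable (fun v => W v * v ^ 0 * evalR r v) volume (-(k : ℝ)) k :=
        (hW.mul_continuousOn (continuousOn_pow 0)).mul_continuousOn (continuous_evalR_rowWL3 _).continuousOn
      have h2 : IntervalIntegrable (fun v => u * (W v * evalR2 rs u v)) volume (-(k : ℝ)) k :=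
        (hW.mul_continuousOn (continuous_evalR2_sndWL3 _ u).continuousOn).const_mul _
      simp_rw [hpt]
      rw [intervalIntegral.integral_add h1 h2, intervalIntegral.integral_const_mul,
        integral_weight_mul_pow_mul_evalR hW hν _ 0, integral_weight_mul_evalR2_rows hW hν u rs]

/-- **Product integration of the innermost variable of rational trivariate rows against real moments**:
`∫_{-l}^{l} W(w) · Σ_i uⁱ q_i(v, w) dw = Σ_i uⁱ Σ_j vʲ · wsumR ξ q_ij 0`. [cite: DavisRabinowitz1984, Sect. 2.5.6] -/
theorem integral_weight_mul_evalR3R {W : ℝ → ℝ} {l : ℚ} (hW : IntervalIntegrable W volume (-(l : ℝ)) l)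
    {ξ : ℕ → ℝ} (hξ : ∀ j : ℕ, ∫ w in (-(l : ℝ))..l, W w * w ^ j = ξ j) (u v : ℝ) :
    ∀ p : List (List Poly), ∫ w in (-(l : ℝ))..l, W w * evalR3 (ratRows3 p) u v w =
      evalR2 (p.map fun q => q.map fun r => wsumR ξ (r.map ((↑) : ℚ → ℝ)) 0) u v
  | [] => by simp
  | q :: qs => by
      simp only [ratRows3_cons, List.map_cons, evalR3_cons, evalR2_cons]
      have hpt : ∀ w : ℝ, W w * (evalR2 (ratRows q) v w + u * evalR3 (ratRows3 qs) u v w) =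
          W w * evalR2 (ratRows q) v w + u * (W w * evalR3 (ratRows3 qs) u v w) := by
        intro w; ring
      have h1 : IntervalIntegrable (fun w => W w * evalR2 (ratRows q) v w) volume (-(l : ℝ)) l :=
        hW.mul_continuousOn (continuous_evalR2_sndWL3 _ v).continuousOn
      have h2 : IntervalIntegrable (fun w => u * (W w * evalR3 (ratRows3 qs) u v w)) volume (-(l : ℝ)) l :=
        (hW.mul_continuousOn (continuous_evalR3_thdWL3 _ u v).continuousOn).const_mul _
      simp_rw [hpt]
      rw [intervalIntegral.integral_add h1 h2, intervalIntegral.integral_const_mul,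
        integral_weight_mul_evalR2R hW hξ v q, integral_weight_mul_evalR3R hW hξ u v qs]

/-- [folklore] -/
private theorem map_rows_wsum2R (ν ξ : ℕ → ℝ) : ∀ p : List (List Poly),
    ((p.map fun q => q.map fun r => wsumR ξ (r.map ((↑) : ℚ → ℝ)) 0).map fun r => wsumR ν r 0) =
      p.map fun q => wsum2R ν ξ q
  | [] => rfl
  | q :: qs => by
      simp only [List.map_cons, map_rows_wsum2R ν ξ qs]
      rfl

/-- **Product integration of a trivariate rational array against real moments**:
`∫_{-h}^{h} WX(u) ∫_{-k}^{k} WY(v) ∫_{-l}^{l} WZ(w) Σ q_ijm uⁱ vʲ wᵐ dw dv du = wsum3R μ ν ξ q`.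
[cite: DavisRabinowitz1984, Sect. 2.5.6] -/
theorem integral3_weight_evalR3R {WX WY WZ : ℝ → ℝ} {h k l : ℚ} (hX : IntervalIntegrable WX volume (-(h : ℝ)) h)
    (hY : IntervalIntegrable WY volume (-(k : ℝ)) k) (hZ : IntervalIntegrable WZ volume (-(l : ℝ)) l)
    {μ ν ξ : ℕ → ℝ} (hμ : ∀ i : ℕ, ∫ u in (-(h : ℝ))..h, WX u * u ^ i = μ i)
    (hν : ∀ j : ℕ, ∫ v in (-(k : ℝ))..k, WY v * v ^ j = ν j)
    (hξ : ∀ j : ℕ, ∫ w in (-(l : ℝ))..l, WZ w * w ^ j = ξ j) (p : List (List Poly)) :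
    ∫ u in (-(h : ℝ))..h, WX u * ∫ v in (-(k : ℝ))..k, WY v * ∫ w in (-(l : ℝ))..l,
      WZ w * evalR3 (ratRows3 p) u v w = wsum3R μ ν ξ p := by
  simp_rw [integral_weight_mul_evalR3R hZ hξ _ _ p, integral_weight_mul_evalR2_rows hY hν]
  rw [map_rows_wsum2R, wsum3R, ← integral_weight_mul_pow_mul_evalR hX hμ _ 0]
  refine intervalIntegral.integral_congr fun u _ => ?_
  simp

/-- [folklore] -/
private theorem intervalIntegrable_weight_mul_bddWL3 {W g : ℝ → ℝ} {k : ℚ} (k0 : 0 ≤ k)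
    (hW : IntervalIntegrable W volume (-(k : ℝ)) k) (hg : Measurable g) {M : ℝ}
    (hb : ∀ v : ℝ, |v| ≤ k → |g v| ≤ M) : IntervalIntegrable (fun v => W v * g v) volume (-(k : ℝ)) k := by
  have hk : (0 : ℝ) ≤ k := by exact_mod_cast k0
  have hle : (-(k : ℝ)) ≤ k := by linarith
  rw [intervalIntegrable_iff_integrableOn_Ioc_of_le hle] at hW ⊢
  refine Integrable.mul_bdd (c := M) hW hg.aestronglyMeasurable ?_
  refine (ae_restrict_iff' measurableSet_Ioc).2 (Filter.Eventually.of_forall fun v hv => ?_)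
  rw [Real.norm_eq_abs]
  exact hb v (abs_le.2 ⟨hv.1.le, hv.2⟩)

/-- Measurability of a parametric interval integral of a jointly measurable function (Fubini–Tonelli).
[folklore] -/
private theorem measurable_intervalIntegral_WL3 {α : Type*} [MeasurableSpace α] {g : α → ℝ → ℝ}
    (hg : Measurable fun q : α × ℝ => g q.1 q.2) (a b : ℝ) : Measurable fun x => ∫ σ in a..b, g x σ := by
  have hsm : StronglyMeasurable (Function.uncurry g) := hg.stronglyMeasurable
  have h1 : StronglyMeasurable fun x => ∫ σ in Set.Ioc a b, g x σ := hsm.integral_prod_right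
  have h2 : StronglyMeasurable fun x => ∫ σ in Set.Ioc b a, g x σ := hsm.integral_prod_right
  simp only [intervalIntegral]
  exact h1.measurable.sub h2.measurable

/-- **The weighted box estimate in three variables with real moments** (product integration of a trivariate Taylor
model against a tensor weight `WX(u) · WY(v) · WZ(w) ≥ 0`: the regular factor is expanded, the weight integrated
exactly against each monomial; op. cit. Sect. 2.12.5–2.12.6 with Sect. 5.6, and Berz–Makino's remainder-times-measure
step with the measure replaced by the zeroth moments).  If `P` encloses a jointly measurable `g` on
`|u| ≤ h, |v| ≤ k, |w| ≤ l` and `μ`, `ν`, `ξ` are the moments of the integrable weights, then for every list of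
rational rows `p`, `|∫∫∫ WX WY WZ g − wsum3R μ ν ξ p| · S ≤ tabs3 (P − p) · μ₀ · ν₀ · ξ₀`; moreover the two iterated
inner integrals and all weighted sections are interval integrable. [cite: DavisRabinowitz1984, Sect. 2.12.6]
[cite: MakinoBerz2003, Algorithm 2] [cite: BerzMakino1999, Sect. 2] -/
theorem weighted_box3R {S : ℕ} (hS : 0 < S) {h k l : ℚ} (h0 : 0 ≤ h) (k0 : 0 ≤ k) (l0 : 0 ≤ l)
    {g : ℝ → ℝ → ℝ → ℝ} (hm : Measurable fun z : ℝ × ℝ × ℝ => g z.1 z.2.1 z.2.2) {P : IPoly3}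
    (hg : TMem3 S h k l g P) {WX WY WZ : ℝ → ℝ} (hYm : Measurable WY) (hZm : Measurable WZ)
    (hXi : IntervalIntegrable WX volume (-(h : ℝ)) h) (hYi : IntervalIntegrable WY volume (-(k : ℝ)) k)
    (hZi : IntervalIntegrable WZ volume (-(l : ℝ)) l)
    (hX0 : ∀ u : ℝ, |u| ≤ h → 0 ≤ WX u) (hY0 : ∀ v : ℝ, |v| ≤ k → 0 ≤ WY v) (hZ0 : ∀ w : ℝ, |w| ≤ l → 0 ≤ WZ w)
    {μ ν ξ : ℕ → ℝ} (hμ : ∀ i : ℕ, ∫ u in (-(h : ℝ))..h, WX u * u ^ i = μ i)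
    (hν : ∀ j : ℕ, ∫ v in (-(k : ℝ))..k, WY v * v ^ j = ν j)
    (hξ : ∀ j : ℕ, ∫ w in (-(l : ℝ))..l, WZ w * w ^ j = ξ j) (p : List (List Poly)) :
    |(∫ u in (-(h : ℝ))..h, ∫ v in (-(k : ℝ))..k, ∫ w in (-(l : ℝ))..l, WX u * (WY v * (WZ w * g u v w))) -
          wsum3R μ ν ξ p| * S ≤
        (tabs3 S h k l (tsub3 P (ratPoly3 S p)) : ℝ) * μ 0 * ν 0 * ξ 0 ∧
      IntervalIntegrable (fun u => ∫ v in (-(k : ℝ))..k, ∫ w in (-(l : ℝ))..l, WX u * (WY v * (WZ w * g u v w)))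
        volume (-(h : ℝ)) h ∧
      (∀ u : ℝ, |u| ≤ h →
        IntervalIntegrable (fun v => ∫ w in (-(l : ℝ))..l, WX u * (WY v * (WZ w * g u v w))) volume (-(k : ℝ)) k) ∧
      ∀ u v : ℝ, |u| ≤ h → |v| ≤ k →
        IntervalIntegrable (fun w => WX u * (WY v * (WZ w * g u v w))) volume (-(l : ℝ)) l := by
  have hSr : (0 : ℝ) < S := by exact_mod_cast hS
  have hhr : (0 : ℝ) ≤ h := by exact_mod_cast h0
  have hkr : (0 : ℝ) ≤ k := by exact_mod_cast k0
  have hlr : (0 : ℝ) ≤ l := by exact_mod_cast l0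
  have hhh : (-(h : ℝ)) ≤ h := by linarith
  have hkk : (-(k : ℝ)) ≤ k := by linarith
  have hll : (-(l : ℝ)) ≤ l := by linarith
  set A : ℤ := tabs3 S h k l P with hA_def
  set Bd : ℤ := tabs3 S h k l (tsub3 P (ratPoly3 S p)) with hBd_def
  -- pointwise bounds from the models
  have hA : ∀ u v w : ℝ, |u| ≤ h → |v| ≤ k → |w| ≤ l → |g u v w| ≤ (A : ℝ) / S := fun u v w hu hv hw => by
    rw [le_div_iff₀ hSr]; exact abs_le_tabs3 h0 k0 l0 hg hu hv hw
  have hdiff := tmem3_sub hg (tmem3_ratPoly3 S h k l p)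
  have hD : ∀ u v w : ℝ, |u| ≤ h → |v| ≤ k → |w| ≤ l →
      |g u v w - evalR3 (ratRows3 p) u v w| ≤ (Bd : ℝ) / S := fun u v w hu hv hw => by
    rw [le_div_iff₀ hSr]; exact abs_le_tabs3 h0 k0 l0 hdiff hu hv hw
  -- the moments of order `0`
  have hμ0 : ∫ u in (-(h : ℝ))..h, WX u = μ 0 := by
    rw [← hμ 0]; exact intervalIntegral.integral_congr fun u _ => by simp
  have hν0 : ∫ v in (-(k : ℝ))..k, WY v = ν 0 := by
    rw [← hν 0]; exact intervalIntegral.integral_congr fun v _ => by simp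
  have hξ0 : ∫ w in (-(l : ℝ))..l, WZ w = ξ 0 := by
    rw [← hξ 0]; exact intervalIntegral.integral_congr fun w _ => by simp
  -- measurability of the sections and of the parametric inner integrals (Fubini integrands)
  have hsec : ∀ u v : ℝ, Measurable fun w => g u v w := fun u v =>
    hm.comp ((measurable_prodMk_left (x := u)).comp (measurable_prodMk_left (x := v)))
  have hm3 : Measurable fun q : (ℝ × ℝ) × ℝ => g q.1.1 q.1.2 q.2 :=
    hm.comp (measurable_fst.fst.prodMk (measurable_fst.snd.prodMk measurable_snd))
  set I1 : ℝ → ℝ → ℝ := fun u v => ∫ w in (-(l : ℝ))..l, WZ w * g u v w with hI1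
  set I2 : ℝ → ℝ := fun u => ∫ v in (-(k : ℝ))..k, WY v * I1 u v with hI2
  have hI1m : Measurable fun q : ℝ × ℝ => I1 q.1 q.2 :=
    measurable_intervalIntegral_WL3 (g := fun (q : ℝ × ℝ) (w : ℝ) => WZ w * g q.1 q.2 w)
      ((hZm.comp measurable_snd).mul hm3) _ _
  have hI1v : ∀ u : ℝ, Measurable fun v => I1 u v := fun u => hI1m.comp (measurable_prodMk_left (x := u))
  have hI2m : Measurable I2 :=
    measurable_intervalIntegral_WL3 (g := fun u v => WY v * I1 u v) ((hYm.comp measurable_snd).mul hI1m) _ _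
  -- integrability of the weighted sections and bounds of the inner integrals
  have hIw : ∀ u v : ℝ, |u| ≤ h → |v| ≤ k → IntervalIntegrable (fun w => WZ w * g u v w) volume (-(l : ℝ)) l :=
    fun u v hu hv => intervalIntegrable_weight_mul_bddWL3 l0 hZi (hsec u v) fun w hw => hA u v w hu hv hw
  have hB1 : ∀ u v : ℝ, |u| ≤ h → |v| ≤ k → |I1 u v| ≤ (A : ℝ) / S * ξ 0 := by
    intro u v hu hv
    have hpt : ∀ᵐ w : ℝ, w ∈ Set.Ioc (-(l : ℝ)) l → ‖WZ w * g u v w‖ ≤ (A : ℝ) / S * WZ w := by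
      refine Filter.Eventually.of_forall fun w hw => ?_
      have hw' : |w| ≤ l := abs_le.2 ⟨hw.1.le, hw.2⟩
      rw [Real.norm_eq_abs, abs_mul, abs_of_nonneg (hZ0 w hw')]
      calc WZ w * |g u v w| ≤ WZ w * ((A : ℝ) / S) := mul_le_mul_of_nonneg_left (hA u v w hu hv hw') (hZ0 w hw')
        _ = (A : ℝ) / S * WZ w := by ring
    have := intervalIntegral.norm_integral_le_of_norm_le hll hpt (hZi.const_mul _)
    rw [intervalIntegral.integral_const_mul, hξ0, Real.norm_eq_abs] at this
    exact this
  have hIv : ∀ u : ℝ, |u| ≤ h → IntervalIntegrable (fun v => WY v * I1 u v) volume (-(k : ℝ)) k := fun u hu =>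
    intervalIntegrable_weight_mul_bddWL3 k0 hYi (hI1v u) fun v hv => hB1 u v hu hv
  have hB2 : ∀ u : ℝ, |u| ≤ h → |I2 u| ≤ (A : ℝ) / S * ξ 0 * ν 0 := by
    intro u hu
    have hpt : ∀ᵐ v : ℝ, v ∈ Set.Ioc (-(k : ℝ)) k → ‖WY v * I1 u v‖ ≤ (A : ℝ) / S * ξ 0 * WY v := by
      refine Filter.Eventually.of_forall fun v hv => ?_
      have hv' : |v| ≤ k := abs_le.2 ⟨hv.1.le, hv.2⟩
      rw [Real.norm_eq_abs, abs_mul, abs_of_nonneg (hY0 v hv')]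
      calc WY v * |I1 u v| ≤ WY v * ((A : ℝ) / S * ξ 0) := mul_le_mul_of_nonneg_left (hB1 u v hu hv') (hY0 v hv')
        _ = (A : ℝ) / S * ξ 0 * WY v := by ring
    have := intervalIntegral.norm_integral_le_of_norm_le hkk hpt (hYi.const_mul _)
    rw [intervalIntegral.integral_const_mul, hν0, Real.norm_eq_abs] at this
    exact this
  have hIu : IntervalIntegrable (fun u => WX u * I2 u) volume (-(h : ℝ)) h :=
    intervalIntegrable_weight_mul_bddWL3 h0 hXi hI2m fun u hu => hB2 u hu
  -- pulling the constant weights out of the inner integrals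
  have e3 : ∀ u v : ℝ, ∫ w in (-(l : ℝ))..l, WX u * (WY v * (WZ w * g u v w)) = WX u * (WY v * I1 u v) := by
    intro u v
    rw [intervalIntegral.integral_const_mul, intervalIntegral.integral_const_mul]
  have e2 : ∀ u : ℝ, ∫ v in (-(k : ℝ))..k, ∫ w in (-(l : ℝ))..l, WX u * (WY v * (WZ w * g u v w)) = WX u * I2 u := by
    intro u
    simp_rw [e3]
    rw [intervalIntegral.integral_const_mul]
  have e2f : (fun u => ∫ v in (-(k : ℝ))..k, ∫ w in (-(l : ℝ))..l, WX u * (WY v * (WZ w * g u v w))) =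
      fun u => WX u * I2 u := funext e2
  have hIρ : IntervalIntegrable
      (fun u => ∫ v in (-(k : ℝ))..k, ∫ w in (-(l : ℝ))..l, WX u * (WY v * (WZ w * g u v w))) volume (-(h : ℝ)) h := by
    rw [e2f]; exact hIu
  have hIσ : ∀ u : ℝ, |u| ≤ h →
      IntervalIntegrable (fun v => ∫ w in (-(l : ℝ))..l, WX u * (WY v * (WZ w * g u v w))) volume (-(k : ℝ)) k := by
    intro u hu
    have e : (fun v => ∫ w in (-(l : ℝ))..l, WX u * (WY v * (WZ w * g u v w))) = fun v => WX u * (WY v * I1 u v) :=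
      funext (e3 u)
    rw [e]; exact (hIv u hu).const_mul _
  have hIτ : ∀ u v : ℝ, |u| ≤ h → |v| ≤ k →
      IntervalIntegrable (fun w => WX u * (WY v * (WZ w * g u v w))) volume (-(l : ℝ)) l :=
    fun u v hu hv => ((hIw u v hu hv).const_mul _).const_mul _
  refine ⟨?_, hIρ, hIσ, hIτ⟩
  -- the estimate: subtract the exactly integrated rational rows, bound pointwise three times against the weights
  have hQw : ∀ u v : ℝ, IntervalIntegrable (fun w => WZ w * evalR3 (ratRows3 p) u v w) volume (-(l : ℝ)) l :=
    fun u v => hZi.mul_continuousOn (continuous_evalR3_thdWL3 _ u v).continuousOn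
  have hQv : ∀ u : ℝ, IntervalIntegrable
      (fun v => WY v * ∫ w in (-(l : ℝ))..l, WZ w * evalR3 (ratRows3 p) u v w) volume (-(k : ℝ)) k := by
    intro u
    simp_rw [integral_weight_mul_evalR3R hZi hξ _ _ p]
    exact hYi.mul_continuousOn (continuous_evalR2_sndWL3 _ u).continuousOn
  have hQu : IntervalIntegrable (fun u => WX u * ∫ v in (-(k : ℝ))..k, WY v * ∫ w in (-(l : ℝ))..l,
      WZ w * evalR3 (ratRows3 p) u v w) volume (-(h : ℝ)) h := by
    simp_rw [integral_weight_mul_evalR3R hZi hξ _ _ p, integral_weight_mul_evalR2_rows hYi hν]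
    exact hXi.mul_continuousOn (continuous_evalR_rowWL3 _).continuousOn
  rw [← integral3_weight_evalR3R hXi hYi hZi hμ hν hξ p, e2f, ← intervalIntegral.integral_sub hIu hQu]
  have hpt : ∀ᵐ u : ℝ, u ∈ Set.Ioc (-(h : ℝ)) h →
      ‖WX u * I2 u - WX u * ∫ v in (-(k : ℝ))..k, WY v * ∫ w in (-(l : ℝ))..l, WZ w * evalR3 (ratRows3 p) u v w‖ ≤
        (Bd : ℝ) / S * ξ 0 * ν 0 * WX u := by
    refine Filter.Eventually.of_forall fun u hu' => ?_
    have hu : |u| ≤ h := abs_le.2 ⟨hu'.1.le, hu'.2⟩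
    have hin2 : |I2 u - ∫ v in (-(k : ℝ))..k, WY v * ∫ w in (-(l : ℝ))..l, WZ w * evalR3 (ratRows3 p) u v w| ≤
        (Bd : ℝ) / S * ξ 0 * ν 0 := by
      simp only [hI2]
      rw [← intervalIntegral.integral_sub (hIv u hu) (hQv u)]
      have hpt' : ∀ᵐ v : ℝ, v ∈ Set.Ioc (-(k : ℝ)) k →
          ‖WY v * I1 u v - WY v * ∫ w in (-(l : ℝ))..l, WZ w * evalR3 (ratRows3 p) u v w‖ ≤
            (Bd : ℝ) / S * ξ 0 * WY v := by
        refine Filter.Eventually.of_forall fun v hv' => ?_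
        have hv : |v| ≤ k := abs_le.2 ⟨hv'.1.le, hv'.2⟩
        have hin1 : |I1 u v - ∫ w in (-(l : ℝ))..l, WZ w * evalR3 (ratRows3 p) u v w| ≤ (Bd : ℝ) / S * ξ 0 := by
          simp only [hI1]
          rw [← intervalIntegral.integral_sub (hIw u v hu hv) (hQw u v)]
          have hpt'' : ∀ᵐ w : ℝ, w ∈ Set.Ioc (-(l : ℝ)) l →
              ‖WZ w * g u v w - WZ w * evalR3 (ratRows3 p) u v w‖ ≤ (Bd : ℝ) / S * WZ w := by
            refine Filter.Eventually.of_forall fun w hw' => ?_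
            have hw : |w| ≤ l := abs_le.2 ⟨hw'.1.le, hw'.2⟩
            rw [← mul_sub, Real.norm_eq_abs, abs_mul, abs_of_nonneg (hZ0 w hw)]
            calc WZ w * |g u v w - evalR3 (ratRows3 p) u v w| ≤ WZ w * ((Bd : ℝ) / S) :=
                mul_le_mul_of_nonneg_left (hD u v w hu hv hw) (hZ0 w hw)
              _ = (Bd : ℝ) / S * WZ w := by ring
          have := intervalIntegral.norm_integral_le_of_norm_le hll hpt'' (hZi.const_mul _)
          rw [intervalIntegral.integral_const_mul, hξ0, Real.norm_eq_abs] at this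
          exact this
        rw [← mul_sub, Real.norm_eq_abs, abs_mul, abs_of_nonneg (hY0 v hv)]
        calc WY v * |I1 u v - ∫ w in (-(l : ℝ))..l, WZ w * evalR3 (ratRows3 p) u v w|
              ≤ WY v * ((Bd : ℝ) / S * ξ 0) := mul_le_mul_of_nonneg_left hin1 (hY0 v hv)
          _ = (Bd : ℝ) / S * ξ 0 * WY v := by ring
      have := intervalIntegral.norm_integral_le_of_norm_le hkk hpt' (hYi.const_mul _)
      rw [intervalIntegral.integral_const_mul, hν0, Real.norm_eq_abs] at this
      exact this
    rw [← mul_sub, Real.norm_eq_abs, abs_mul, abs_of_nonneg (hX0 u hu)]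
    calc WX u * |I2 u - ∫ v in (-(k : ℝ))..k, WY v * ∫ w in (-(l : ℝ))..l, WZ w * evalR3 (ratRows3 p) u v w|
          ≤ WX u * ((Bd : ℝ) / S * ξ 0 * ν 0) := mul_le_mul_of_nonneg_left hin2 (hX0 u hu)
      _ = (Bd : ℝ) / S * ξ 0 * ν 0 * WX u := by ring
  have := intervalIntegral.norm_integral_le_of_norm_le hhh hpt (hXi.const_mul _)
  rw [intervalIntegral.integral_const_mul, hμ0, Real.norm_eq_abs] at this
  have h1 := mul_le_mul_of_nonneg_right this hSr.le
  have h2 : (Bd : ℝ) / S * ξ 0 * ν 0 * μ 0 * S = (Bd : ℝ) * μ 0 * ν 0 * ξ 0 := by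
    rw [div_mul_eq_mul_div, div_mul_eq_mul_div, div_mul_eq_mul_div,
      div_mul_cancel_of_imp (fun h0 => absurd h0 hSr.ne')]
    ring
  rw [h2] at h1
  exact h1

/-! ### Part 2. The interval pairing in three variables -/

/-- Interval pairing of rational trivariate rows with interval moments in the three variables (scale `T`): encloses
`wsum3R μ ν ξ p`. [cite: DavisRabinowitz1984, Sect. 2.5.6] -/
def wsum3I (T : ℕ) (M N X : ℕ → MI) (p : List (List Poly)) : MI := wsumIM T M (p.map fun q => wsum2I T N X q) 0

/-- **Inclusion of the interval pairing**: `wsum3R μ ν ξ p ∈ wsum3I T M N X p` whenever `μ_i ∈ M i`, `ν_j ∈ N j`,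
`ξ_m ∈ X m`. [cite: DavisRabinowitz1984, Sect. 2.5.6] -/
theorem mem_wsum3I {T : ℕ} (hT : 0 < T) {μ ν ξ : ℕ → ℝ} {M N X : ℕ → MI} (hM : ∀ i : ℕ, MI.mem T (μ i) (M i))
    (hN : ∀ j : ℕ, MI.mem T (ν j) (N j)) (hX : ∀ j : ℕ, MI.mem T (ξ j) (X j)) (p : List (List Poly)) :
    MI.mem T (wsum3R μ ν ξ p) (wsum3I T M N X p) := by
  have hF : ∀ p : List (List Poly), List.Forall₂ (fun x J => MI.mem T x J)
      (p.map fun q => wsum2R ν ξ q) (p.map fun q => wsum2I T N X q) := by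
    intro p
    induction p with
    | nil => exact List.Forall₂.nil
    | cons q qs ih =>
        simp only [List.map_cons]
        exact List.Forall₂.cons (mem_wsum2I hT hN hX q) ih
  exact mem_wsumIM hT hM _ _ (hF p) 0

/-! ### Part 3. Face weights in three variables, the leaf rule and its soundness -/

/-- **Weight descriptor in three variables**: the exponents and logarithmic powers of the algebraic–logarithmic face
weight `w(x, y, z) = Π_{t ∈ {x, y, z}} (t − t0)^{αl} (−log(t − t0))^{κl} (t1 − t)^{αr} (−log(t1 − t))^{κr}` attached to
the ROOT box (an exponent `0` with logarithmic power `0` means no factor; a factor's exponent must exceed `−1`), and two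
soundness-free precision knobs: the internal scale `T` of the interval moments and the series budget `KL` of their
logarithms. [cite: DavisRabinowitz1984, Sect. 2.12.6] [cite: DavisRabinowitz1984, Sect. 5.6] -/
structure WLPrm3 where
  /-- exponent at the face `x = x0` -/
  xl : ℚ
  /-- exponent at the face `x = x1` -/
  xr : ℚ
  /-- exponent at the face `y = y0` -/
  yl : ℚ
  /-- exponent at the face `y = y1` -/
  yr : ℚ
  /-- exponent at the face `z = z0` -/
  zl : ℚ
  /-- exponent at the face `z = z1` -/
  zr : ℚ
  /-- logarithmic power at `x = x0` -/
  kxl : ℕ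
  /-- logarithmic power at `x = x1` -/
  kxr : ℕ
  /-- logarithmic power at `y = y0` -/
  kyl : ℕ
  /-- logarithmic power at `y = y1` -/
  kyr : ℕ
  /-- logarithmic power at `z = z0` -/
  kzl : ℕ
  /-- logarithmic power at `z = z1` -/
  kzr : ℕ
  /-- internal scale of the interval moments (precision knob) -/
  T : ℕ
  /-- series terms for the logarithms of the face distances (precision knob) -/
  KL : ℕ

/-- **The weighted integrand** `w_x(x) · (w_y(y) · (w_z(z) · F(x, y, z)))` on the root box `R`, each `w_t` the
direction's `edgeWL`. [cite: DavisRabinowitz1984, Sect. 2.12.6] [cite: DavisRabinowitz1984, Sect. 5.6] -/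
noncomputable def wfunL3 (ω : WLPrm3) (R : Box3Q) (F : BExpr3T) (x y z : ℝ) : ℝ :=
  edgeWL R.x0 R.x1 ω.xl ω.xr ω.kxl ω.kxr x *
    (edgeWL R.y0 R.y1 ω.yl ω.yr ω.kyl ω.kyr y * (edgeWL R.z0 R.z1 ω.zl ω.zr ω.kzl ω.kzr z * F.toFun₃ x y z))

/-- Attach the code-list factor `A^α = exp (α · log A)` to `E` (three variables) unless the face is carried by the
moments or `α = 0`. [cite: DavisRabinowitz1984, Sect. 2.12.4] -/
def withPow3 (t : Bool) (α : ℚ) (A E : BExpr3T) : BExpr3T :=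
  if (!t && decide (α ≠ 0)) = true then
    BExpr3T.mul E (BExpr3T.exp (BExpr3T.mul (BExpr3T.const α) (BExpr3T.log A)))
  else E

/-- [cite: DavisRabinowitz1984, Sect. 2.12.4] -/
theorem toFun₃_withPow3 (t : Bool) (α : ℚ) (A E : BExpr3T) (x y z : ℝ) :
    (withPow3 t α A E).toFun₃ x y z = E.toFun₃ x y z * facR t α (A.toFun₃ x y z) := by
  unfold withPow3 facR
  by_cases hb : (!t && decide (α ≠ 0)) = true
  · rw [if_pos hb, if_pos hb]
    simp only [BExpr3T.toFun₃]
  · rw [if_neg hb, if_neg hb, mul_one]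

/-- The code list `(−log A)^n` by repeated products (three variables). [cite: DavisRabinowitz1984, Sect. 2.12.4] -/
def nlogPow3 (A : BExpr3T) : ℕ → BExpr3T
  | 0 => BExpr3T.const 1
  | n + 1 => BExpr3T.mul (nlogPow3 A n) (BExpr3T.neg (BExpr3T.log A))

/-- [cite: DavisRabinowitz1984, Sect. 2.12.4] -/
theorem toFun₃_nlogPow3 (A : BExpr3T) (x y z : ℝ) :
    ∀ n : ℕ, (nlogPow3 A n).toFun₃ x y z = (-Real.log (A.toFun₃ x y z)) ^ n
  | 0 => by simp [nlogPow3, BExpr3T.toFun₃]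
  | n + 1 => by
      simp only [nlogPow3, BExpr3T.toFun₃, toFun₃_nlogPow3 A x y z n, pow_succ]

/-- Attach the code-list factor `(−log A)^κ` to `E` unless the face is carried by the moments or `κ = 0`.
[cite: DavisRabinowitz1984, Sect. 2.12.4] -/
def withLogPow3 (t : Bool) (κ : ℕ) (A E : BExpr3T) : BExpr3T :=
  if (!t && decide (κ ≠ 0)) = true then BExpr3T.mul E (nlogPow3 A κ) else E

/-- [cite: DavisRabinowitz1984, Sect. 2.12.4] -/
theorem toFun₃_withLogPow3 (t : Bool) (κ : ℕ) (A E : BExpr3T) (x y z : ℝ) :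
    (withLogPow3 t κ A E).toFun₃ x y z = E.toFun₃ x y z * facL t κ (A.toFun₃ x y z) := by
  unfold withLogPow3 facL
  by_cases hb : (!t && decide (κ ≠ 0)) = true
  · rw [if_pos hb, if_pos hb]
    simp only [BExpr3T.toFun₃, toFun₃_nlogPow3]
  · rw [if_neg hb, if_neg hb, mul_one]

/-- **The smooth part of the weighted integrand on a leaf, as a code list in three variables**: `F` times the face
factors NOT carried by the moments, each as `exp (α log d) · (−log d)^κ`. [cite: DavisRabinowitz1984, Sect. 2.12.4] -/
def gexprL3 (F : BExpr3T) (ω : WLPrm3) (R : Box3Q) (mx0 mx1 my0 my1 mz0 mz1 : Bool) : BExpr3T :=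
  withPow3 mx0 ω.xl (BExpr3T.sub BExpr3T.varX (BExpr3T.const R.x0))
    (withLogPow3 mx0 ω.kxl (BExpr3T.sub BExpr3T.varX (BExpr3T.const R.x0))
      (withPow3 mx1 ω.xr (BExpr3T.sub (BExpr3T.const R.x1) BExpr3T.varX)
        (withLogPow3 mx1 ω.kxr (BExpr3T.sub (BExpr3T.const R.x1) BExpr3T.varX)
          (withPow3 my0 ω.yl (BExpr3T.sub BExpr3T.varY (BExpr3T.const R.y0))
            (withLogPow3 my0 ω.kyl (BExpr3T.sub BExpr3T.varY (BExpr3T.const R.y0))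
              (withPow3 my1 ω.yr (BExpr3T.sub (BExpr3T.const R.y1) BExpr3T.varY)
                (withLogPow3 my1 ω.kyr (BExpr3T.sub (BExpr3T.const R.y1) BExpr3T.varY)
                  (withPow3 mz0 ω.zl (BExpr3T.sub BExpr3T.varZ (BExpr3T.const R.z0))
                    (withLogPow3 mz0 ω.kzl (BExpr3T.sub BExpr3T.varZ (BExpr3T.const R.z0))
                      (withPow3 mz1 ω.zr (BExpr3T.sub (BExpr3T.const R.z1) BExpr3T.varZ)
                        (withLogPow3 mz1 ω.kzr (BExpr3T.sub (BExpr3T.const R.z1) BExpr3T.varZ)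
                          F)))))))))))

/-- [cite: DavisRabinowitz1984, Sect. 2.12.4] -/
theorem toFun₃_gexprL3 (F : BExpr3T) (ω : WLPrm3) (R : Box3Q) (mx0 mx1 my0 my1 mz0 mz1 : Bool) (x y z : ℝ) :
    (gexprL3 F ω R mx0 mx1 my0 my1 mz0 mz1).toFun₃ x y z =
      F.toFun₃ x y z * facL mz1 ω.kzr ((R.z1 : ℝ) - z) * facR mz1 ω.zr ((R.z1 : ℝ) - z) *
        facL mz0 ω.kzl (z - R.z0) * facR mz0 ω.zl (z - R.z0) *
        facL my1 ω.kyr ((R.y1 : ℝ) - y) * facR my1 ω.yr ((R.y1 : ℝ) - y) *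
        facL my0 ω.kyl (y - R.y0) * facR my0 ω.yl (y - R.y0) *
        facL mx1 ω.kxr ((R.x1 : ℝ) - x) * facR mx1 ω.xr ((R.x1 : ℝ) - x) *
        facL mx0 ω.kxl (x - R.x0) * facR mx0 ω.xl (x - R.x0) := by
  simp only [gexprL3, toFun₃_withPow3, toFun₃_withLogPow3, BExpr3T.toFun₃]

/-- [folklore] -/
private theorem measurable_algLogW3 (α : ℚ) (κ : ℕ) : Measurable (algLogW α κ) := by
  unfold algLogW
  exact (measurable_id.pow_const _).mul ((Real.measurable_log.neg).pow_const _)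

/-- [folklore] -/
private theorem measurable_dirWL3 (h dl dr αl αr : ℚ) (κl κr : ℕ) (ml mr : Bool) :
    Measurable (dirWL h dl dr αl αr κl κr ml mr) := by
  have h1 : Measurable (wLL ml (dl + h) αl κl) := by
    cases ml
    · have e : wLL false (dl + h) αl κl = fun _ => (1 : ℝ) := by funext u; simp
      rw [e]; exact measurable_const
    · have e : wLL true (dl + h) αl κl = fun u : ℝ => algLogW αl κl (u + ((dl + h : ℚ) : ℝ)) := by
        funext u; simp
      rw [e]; exact (measurable_algLogW3 αl κl).comp (measurable_id.add_const _)
  have h2 : Measurable (wRL mr (dr + h) αr κr) := by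
    cases mr
    · have e : wRL false (dr + h) αr κr = fun _ => (1 : ℝ) := by funext u; simp
      rw [e]; exact measurable_const
    · have e : wRL true (dr + h) αr κr = fun u : ℝ => algLogW αr κr (((dr + h : ℚ) : ℝ) - u) := by
        funext u; simp
      rw [e]; exact (measurable_algLogW3 αr κr).comp (measurable_const.sub measurable_id)
  exact h1.mul h2

/-- **The leaf rule of the face-weighted 3-D certificate** for the leaf `B` of a kd-tree over the ROOT box `R`: local
centre, half-widths and distances to the root's faces; per direction the plan `dirPlanL` and the interval moments
`dirMomL` (scale `ω.T`); the trivariate Taylor model of the smooth part `gexprL3` (order / budgets `P`); its rational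
midpoint rows `q` paired IN INTERVAL ARITHMETIC with the three moment sequences (`wsum3I`), rescaled to `S` and
widened by `⌈tabs3 (model − q) · μ̄₀ · ν̄₀ · ξ̄₀⌉` (upper ends of the zeroth moments); accepted iff `0 < T`, the model
and all three directions' moments are accepted, every algebraic factor left to the model is separated from its face
(or absent), `B ⊆ R`, and `B` is correctly oriented. [cite: DavisRabinowitz1984, Sect. 2.12.6]
[cite: DavisRabinowitz1984, Sect. 5.6] [cite: MakinoBerz2003, Algorithm 2] -/
def leafEnclWL3 (S : ℕ) (F : BExpr3T) (ω : WLPrm3) (R B : Box3Q) (P : EPrm) : MI × Bool :=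
  let h := (B.x1 - B.x0) / 2
  let k := (B.y1 - B.y0) / 2
  let l := (B.z1 - B.z0) / 2
  let dlx := B.x0 - R.x0
  let drx := R.x1 - B.x1
  let dly := B.y0 - R.y0
  let dry := R.y1 - B.y1
  let dlz := B.z0 - R.z0
  let drz := R.z1 - B.z1
  let px := dirPlanL ω.T ω.KL h dlx drx ω.xl ω.xr ω.kxl ω.kxr
  let py := dirPlanL ω.T ω.KL k dly dry ω.yl ω.yr ω.kyl ω.kyr
  let pz := dirPlanL ω.T ω.KL l dlz drz ω.zl ω.zr ω.kzl ω.kzr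
  let m := BExpr3T.model S h k l P ((B.x0 + B.x1) / 2) ((B.y0 + B.y1) / 2) ((B.z0 + B.z1) / 2)
    (gexprL3 F ω R px.1 px.2 py.1 py.2 pz.1 pz.2)
  let q := midRows3 S m.1
  let dx := dirMomL ω.T ω.KL h dlx drx ω.xl ω.xr ω.kxl ω.kxr px.1 px.2
  let dy := dirMomL ω.T ω.KL k dly dry ω.yl ω.yr ω.kyl ω.kyr py.1 py.2
  let dz := dirMomL ω.T ω.KL l dlz drz ω.zl ω.zr ω.kzl ω.kzr pz.1 pz.2
  (MI.widen (MI.rescale ω.T S (wsum3I ω.T dx.1 dy.1 dz.1 q))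
      ⌈(tabs3 S h k l (tsub3 m.1 (ratPoly3 S q)) : ℚ) * (((dx.1 0).hi : ℚ) / ω.T) * (((dy.1 0).hi : ℚ) / ω.T) *
        (((dz.1 0).hi : ℚ) / ω.T)⌉,
    decide (0 < ω.T) && m.2 && dx.2 && dy.2 && dz.2 &&
      (px.1 || decide (ω.xl = 0) || decide (R.x0 < B.x0)) && (px.2 || decide (ω.xr = 0) || decide (B.x1 < R.x1)) &&
      (py.1 || decide (ω.yl = 0) || decide (R.y0 < B.y0)) && (py.2 || decide (ω.yr = 0) || decide (B.y1 < R.y1)) &&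
      (pz.1 || decide (ω.zl = 0) || decide (R.z0 < B.z0)) && (pz.2 || decide (ω.zr = 0) || decide (B.z1 < R.z1)) &&
      decide (R.x0 ≤ B.x0) && decide (B.x1 ≤ R.x1) && decide (R.y0 ≤ B.y0) && decide (B.y1 ≤ R.y1) &&
      decide (R.z0 ≤ B.z0) && decide (B.z1 ≤ R.z1) &&
      decide (B.x0 ≤ B.x1) && decide (B.y0 ≤ B.y1) && decide (B.z0 ≤ B.z1))

/-- [folklore] -/
private theorem sep_of_flagWL3 {t : Bool} {α a b : ℚ} (h : (t = true ∨ α = 0) ∨ a < b) :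
    t = false → α ≠ 0 → a < b := by
  intro ht hα
  rcases h with (h | h) | h
  · rw [ht] at h; exact absurd h Bool.false_ne_true
  · exact absurd h hα
  · exact h

/-- **Soundness of the leaf rule**: an accepted leaf encloses `S · ∫_B w · F` and provides the integrability facts of
`BoxClaim3R`. [cite: DavisRabinowitz1984, Sect. 2.12.6] [cite: DavisRabinowitz1984, Sect. 5.6]
[cite: MakinoBerz2003, Algorithm 2] -/
theorem leafEnclWL3_sound {S : ℕ} (hS : 0 < S) (F : BExpr3T) (ω : WLPrm3) (R B : Box3Q) (P : EPrm)
    (hok : (leafEnclWL3 S F ω R B P).2 = true) :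
    BoxClaim3R S (wfunL3 ω R F) B (leafEnclWL3 S F ω R B P).1 := by
  simp only [leafEnclWL3, Bool.and_eq_true, Bool.or_eq_true, decide_eq_true_eq] at hok ⊢
  obtain ⟨⟨⟨⟨⟨⟨⟨⟨⟨⟨⟨⟨⟨⟨⟨⟨⟨⟨⟨hT, hacc⟩, hdx⟩, hdy⟩, hdz⟩, hsx0⟩, hsx1⟩, hsy0⟩, hsy1⟩, hsz0⟩, hsz1⟩, hRx0⟩,
    hRx1⟩, hRy0⟩, hRy1⟩, hRz0⟩, hRz1⟩, hx⟩, hy⟩, hz⟩ := hok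
  set h : ℚ := (B.x1 - B.x0) / 2 with hh
  set k : ℚ := (B.y1 - B.y0) / 2 with hk
  set l : ℚ := (B.z1 - B.z0) / 2 with hl
  set cx : ℚ := (B.x0 + B.x1) / 2 with hcx
  set cy : ℚ := (B.y0 + B.y1) / 2 with hcy
  set cz : ℚ := (B.z0 + B.z1) / 2 with hcz
  set dlx : ℚ := B.x0 - R.x0 with hdlx
  set drx : ℚ := R.x1 - B.x1 with hdrx
  set dly : ℚ := B.y0 - R.y0 with hdly
  set dry : ℚ := R.y1 - B.y1 with hdry
  set dlz : ℚ := B.z0 - R.z0 with hdlz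
  set drz : ℚ := R.z1 - B.z1 with hdrz
  set px : Bool × Bool := dirPlanL ω.T ω.KL h dlx drx ω.xl ω.xr ω.kxl ω.kxr with hpx
  set py : Bool × Bool := dirPlanL ω.T ω.KL k dly dry ω.yl ω.yr ω.kyl ω.kyr with hpy
  set pz : Bool × Bool := dirPlanL ω.T ω.KL l dlz drz ω.zl ω.zr ω.kzl ω.kzr with hpz
  set G : BExpr3T := gexprL3 F ω R px.1 px.2 py.1 py.2 pz.1 pz.2 with hG
  set q : List (List Poly) := midRows3 S (BExpr3T.model S h k l P cx cy cz G).1 with hq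
  set dx := dirMomL ω.T ω.KL h dlx drx ω.xl ω.xr ω.kxl ω.kxr px.1 px.2 with hdxd
  set dy := dirMomL ω.T ω.KL k dly dry ω.yl ω.yr ω.kyl ω.kyr py.1 py.2 with hdyd
  set dz := dirMomL ω.T ω.KL l dlz drz ω.zl ω.zr ω.kzl ω.kzr pz.1 pz.2 with hdzd
  have h0 : 0 ≤ h := by rw [hh]; linarith
  have k0 : 0 ≤ k := by rw [hk]; linarith
  have l0 : 0 ≤ l := by rw [hl]; linarith
  have hhr : (0 : ℝ) ≤ h := by exact_mod_cast h0
  have hkr : (0 : ℝ) ≤ k := by exact_mod_cast k0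
  have hlr : (0 : ℝ) ≤ l := by exact_mod_cast l0
  have hTr : (0 : ℝ) < ω.T := by exact_mod_cast hT
  have hTM := BExpr3T.tmem3_model hS h0 k0 l0 P cx cy cz G hacc
  have hm : Measurable fun w : ℝ × ℝ × ℝ => G.toFun₃ ((cx : ℝ) + w.1) ((cy : ℝ) + w.2.1) ((cz : ℝ) + w.2.2) :=
    (BExpr3T.measurable_toFun₃ G).comp
      ((measurable_const.add measurable_fst).prodMk
        ((measurable_const.add measurable_snd.fst).prodMk (measurable_const.add measurable_snd.snd)))
  obtain ⟨hXi, hX0, hμ⟩ := dirMomL_sound (dl := dlx) (dr := drx) (αl := ω.xl) (αr := ω.xr) (κl := ω.kxl)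
    (κr := ω.kxr) (ml := px.1) (mr := px.2) hT h0 hdx
  obtain ⟨hYi, hY0, hν⟩ := dirMomL_sound (dl := dly) (dr := dry) (αl := ω.yl) (αr := ω.yr) (κl := ω.kyl)
    (κr := ω.kyr) (ml := py.1) (mr := py.2) hT k0 hdy
  obtain ⟨hZi, hZ0, hξ⟩ := dirMomL_sound (dl := dlz) (dr := drz) (αl := ω.zl) (αr := ω.zr) (κl := ω.kzl)
    (κr := ω.kzr) (ml := pz.1) (mr := pz.2) hT l0 hdz
  set WX : ℝ → ℝ := dirWL h dlx drx ω.xl ω.xr ω.kxl ω.kxr px.1 px.2 with hWX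
  set WY : ℝ → ℝ := dirWL k dly dry ω.yl ω.yr ω.kyl ω.kyr py.1 py.2 with hWY
  set WZ : ℝ → ℝ := dirWL l dlz drz ω.zl ω.zr ω.kzl ω.kzr pz.1 pz.2 with hWZ
  set μ : ℕ → ℝ := fun i => ∫ u in (-(h : ℝ))..h, WX u * u ^ i with hμd
  set ν : ℕ → ℝ := fun j => ∫ v in (-(k : ℝ))..k, WY v * v ^ j with hνd
  set ξ : ℕ → ℝ := fun j => ∫ w in (-(l : ℝ))..l, WZ w * w ^ j with hξd
  obtain ⟨hest, hI, hσ, hτ⟩ :=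
    weighted_box3R hS h0 k0 l0 hm hTM (measurable_dirWL3 k dly dry ω.yl ω.yr ω.kyl ω.kyr py.1 py.2)
      (measurable_dirWL3 l dlz drz ω.zl ω.zr ω.kzl ω.kzr pz.1 pz.2) hXi hYi hZi hX0 hY0 hZ0
      (μ := μ) (ν := ν) (ξ := ξ) (fun i => rfl) (fun j => rfl) (fun j => rfl) q
  -- the pointwise identity on the closed leaf
  have hcmx0 : cx - (dlx + h) = R.x0 := by rw [hcx, hh, hdlx]; ring
  have hcmx1 : cx + (drx + h) = R.x1 := by rw [hcx, hh, hdrx]; ring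
  have hcmy0 : cy - (dly + k) = R.y0 := by rw [hcy, hk, hdly]; ring
  have hcmy1 : cy + (dry + k) = R.y1 := by rw [hcy, hk, hdry]; ring
  have hcmz0 : cz - (dlz + l) = R.z0 := by rw [hcz, hl, hdlz]; ring
  have hcmz1 : cz + (drz + l) = R.z1 := by rw [hcz, hl, hdrz]; ring
  have hpt : ∀ x : ℝ, (B.x0 : ℝ) ≤ x → x ≤ B.x1 → ∀ y : ℝ, (B.y0 : ℝ) ≤ y → y ≤ B.y1 →
      ∀ z : ℝ, (B.z0 : ℝ) ≤ z → z ≤ B.z1 →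
        wfunL3 ω R F x y z = WX (x - cx) * (WY (y - cy) * (WZ (z - cz) * G.toFun₃ x y z)) := by
    intro x hx0 hx1 y hy0 hy1 z hz0 hz1
    simp only [wfunL3, edgeWL, hWX, hWY, hWZ, dirWL, hG, toFun₃_gexprL3]
    rw [algLogW_left_split ω.kxl hcmx0 (sep_of_flagWL3 hsx0) hx0,
      algLogW_right_split ω.kxr hcmx1 (sep_of_flagWL3 hsx1) hx1,
      algLogW_left_split ω.kyl hcmy0 (sep_of_flagWL3 hsy0) hy0,
      algLogW_right_split ω.kyr hcmy1 (sep_of_flagWL3 hsy1) hy1,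
      algLogW_left_split ω.kzl hcmz0 (sep_of_flagWL3 hsz0) hz0,
      algLogW_right_split ω.kzr hcmz1 (sep_of_flagWL3 hsz1) hz1]
    ring
  -- the translated limits and integrals
  have ex0 : (cx : ℝ) + -(h : ℝ) = (B.x0 : ℝ) := by rw [hcx, hh]; push_cast; ring
  have ex1 : (cx : ℝ) + (h : ℝ) = (B.x1 : ℝ) := by rw [hcx, hh]; push_cast; ring
  have ey0 : (cy : ℝ) + -(k : ℝ) = (B.y0 : ℝ) := by rw [hcy, hk]; push_cast; ring
  have ey1 : (cy : ℝ) + (k : ℝ) = (B.y1 : ℝ) := by rw [hcy, hk]; push_cast; ring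
  have ez0 : (cz : ℝ) + -(l : ℝ) = (B.z0 : ℝ) := by rw [hcz, hl]; push_cast; ring
  have ez1 : (cz : ℝ) + (l : ℝ) = (B.z1 : ℝ) := by rw [hcz, hl]; push_cast; ring
  have e3 : ∀ x y : ℝ, ∫ z in (B.z0 : ℝ)..B.z1, WX (x - cx) * (WY (y - cy) * (WZ (z - cz) * G.toFun₃ x y z)) =
      ∫ w in (-(l : ℝ))..l, WX (x - cx) * (WY (y - cy) *
        (WZ w * G.toFun₃ ((cx : ℝ) + (x - cx)) ((cy : ℝ) + (y - cy)) ((cz : ℝ) + w))) := by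
    intro x y
    have e1 := intervalIntegral.integral_comp_add_left
      (fun z => WX (x - cx) * (WY (y - cy) * (WZ (z - cz) * G.toFun₃ x y z))) (cz : ℝ) (a := -(l : ℝ)) (b := l)
    rw [ez0, ez1] at e1
    rw [← e1]
    refine intervalIntegral.integral_congr fun w _ => ?_
    simp only [add_sub_cancel_left, add_sub_cancel]
  have e2 : ∀ x : ℝ, ∫ y in (B.y0 : ℝ)..B.y1, ∫ w in (-(l : ℝ))..l, WX (x - cx) * (WY (y - cy) *
        (WZ w * G.toFun₃ ((cx : ℝ) + (x - cx)) ((cy : ℝ) + (y - cy)) ((cz : ℝ) + w))) =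
      ∫ v in (-(k : ℝ))..k, ∫ w in (-(l : ℝ))..l, WX (x - cx) * (WY v *
        (WZ w * G.toFun₃ ((cx : ℝ) + (x - cx)) ((cy : ℝ) + v) ((cz : ℝ) + w))) := by
    intro x
    have e1 := intervalIntegral.integral_comp_add_left
      (fun y => ∫ w in (-(l : ℝ))..l, WX (x - cx) * (WY (y - cy) *
        (WZ w * G.toFun₃ ((cx : ℝ) + (x - cx)) ((cy : ℝ) + (y - cy)) ((cz : ℝ) + w))))
      (cy : ℝ) (a := -(k : ℝ)) (b := k)
    rw [ey0, ey1] at e1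
    rw [← e1]
    refine intervalIntegral.integral_congr fun v _ => ?_
    simp only [add_sub_cancel_left]
  have e1 : ∫ x in (B.x0 : ℝ)..B.x1, ∫ v in (-(k : ℝ))..k, ∫ w in (-(l : ℝ))..l, WX (x - cx) * (WY v *
        (WZ w * G.toFun₃ ((cx : ℝ) + (x - cx)) ((cy : ℝ) + v) ((cz : ℝ) + w))) =
      ∫ u in (-(h : ℝ))..h, ∫ v in (-(k : ℝ))..k, ∫ w in (-(l : ℝ))..l, WX u * (WY v *
        (WZ w * G.toFun₃ ((cx : ℝ) + u) ((cy : ℝ) + v) ((cz : ℝ) + w))) := by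
    have e1 := intervalIntegral.integral_comp_add_left
      (fun x => ∫ v in (-(k : ℝ))..k, ∫ w in (-(l : ℝ))..l, WX (x - cx) * (WY v *
        (WZ w * G.toFun₃ ((cx : ℝ) + (x - cx)) ((cy : ℝ) + v) ((cz : ℝ) + w))))
      (cx : ℝ) (a := -(h : ℝ)) (b := h)
    rw [ex0, ex1] at e1
    rw [← e1]
    refine intervalIntegral.integral_congr fun u _ => ?_
    simp only [add_sub_cancel_left]
  have hxx : (B.x0 : ℝ) ≤ B.x1 := by exact_mod_cast hx
  have hyy : (B.y0 : ℝ) ≤ B.y1 := by exact_mod_cast hy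
  have hzz : (B.z0 : ℝ) ≤ B.z1 := by exact_mod_cast hz
  refine ⟨?_, ?_, ?_, ?_, hx, hy, hz⟩
  · -- membership: the integral over the leaf is the local weighted integral
    have ecast : ∫ x in (B.x0 : ℝ)..B.x1, ∫ y in (B.y0 : ℝ)..B.y1, ∫ z in (B.z0 : ℝ)..B.z1, wfunL3 ω R F x y z =
        ∫ x in (B.x0 : ℝ)..B.x1, ∫ y in (B.y0 : ℝ)..B.y1, ∫ z in (B.z0 : ℝ)..B.z1,
          WX (x - cx) * (WY (y - cy) * (WZ (z - cz) * G.toFun₃ x y z)) := by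
      refine intervalIntegral.integral_congr fun x hx' => ?_
      rw [uIcc_of_le hxx] at hx'
      refine intervalIntegral.integral_congr fun y hy' => ?_
      rw [uIcc_of_le hyy] at hy'
      refine intervalIntegral.integral_congr fun z hz' => ?_
      rw [uIcc_of_le hzz] at hz'
      exact hpt x hx'.1 hx'.2 y hy'.1 hy'.2 z hz'.1 hz'.2
    rw [ecast]
    simp_rw [e3]
    simp_rw [e2]
    rw [e1]
    have hmemW : MI.mem S (wsum3R μ ν ξ q) (MI.rescale ω.T S (wsum3I ω.T dx.1 dy.1 dz.1 q)) :=
      MI.mem_rescale hT S (mem_wsum3I hT hμ hν hξ q)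
    refine MI.mem_widen hmemW (hest.trans ?_)
    -- `tabs3 · μ₀ · ν₀ · ξ₀ ≤ ⌈tabs3 · μ̄₀ · ν̄₀ · ξ̄₀⌉`
    have hμ0 : μ 0 ≤ (((dx.1 0).hi : ℤ) : ℝ) / ω.T := MI.le_hi_div hT (hμ 0)
    have hν0 : ν 0 ≤ (((dy.1 0).hi : ℤ) : ℝ) / ω.T := MI.le_hi_div hT (hν 0)
    have hξ0 : ξ 0 ≤ (((dz.1 0).hi : ℤ) : ℝ) / ω.T := MI.le_hi_div hT (hξ 0)
    have hμ0nn : 0 ≤ μ 0 := by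
      simp only [hμd]
      refine intervalIntegral.integral_nonneg (by linarith) fun u hu => ?_
      rw [pow_zero, mul_one]
      exact hX0 u (abs_le.2 ⟨hu.1, hu.2⟩)
    have hν0nn : 0 ≤ ν 0 := by
      simp only [hνd]
      refine intervalIntegral.integral_nonneg (by linarith) fun v hv => ?_
      rw [pow_zero, mul_one]
      exact hY0 v (abs_le.2 ⟨hv.1, hv.2⟩)
    have hξ0nn : 0 ≤ ξ 0 := by
      simp only [hξd]
      refine intervalIntegral.integral_nonneg (by linarith) fun w hw => ?_
      rw [pow_zero, mul_one]
      exact hZ0 w (abs_le.2 ⟨hw.1, hw.2⟩)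
    have hdiff := tmem3_sub hTM (tmem3_ratPoly3 S h k l q)
    have htabs : (0 : ℝ) ≤ (tabs3 S h k l (tsub3 (BExpr3T.model S h k l P cx cy cz G).1 (ratPoly3 S q)) : ℝ) := by
      have h1 := abs_le_tabs3 h0 k0 l0 hdiff (ρ := 0) (σ := 0) (τ := 0) (by simpa using hhr) (by simpa using hkr)
        (by simpa using hlr)
      exact le_trans (by positivity) h1
    set Tb : ℝ := (tabs3 S h k l (tsub3 (BExpr3T.model S h k l P cx cy cz G).1 (ratPoly3 S q)) : ℝ) with hTb
    have hchain : Tb * μ 0 * ν 0 * ξ 0 ≤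
        Tb * ((((dx.1 0).hi : ℤ) : ℝ) / ω.T) * ((((dy.1 0).hi : ℤ) : ℝ) / ω.T) * ((((dz.1 0).hi : ℤ) : ℝ) / ω.T) := by
      have h12 : Tb * μ 0 * ν 0 ≤ Tb * ((((dx.1 0).hi : ℤ) : ℝ) / ω.T) * ((((dy.1 0).hi : ℤ) : ℝ) / ω.T) :=
        mul_le_mul (mul_le_mul_of_nonneg_left hμ0 htabs) hν0 hν0nn (mul_nonneg htabs (hμ0nn.trans hμ0))
      exact mul_le_mul h12 hξ0 hξ0nn
        (mul_nonneg (mul_nonneg htabs (hμ0nn.trans hμ0)) (hν0nn.trans hν0))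
    refine hchain.trans ?_
    have hceil := Int.le_ceil ((tabs3 S h k l (tsub3 (BExpr3T.model S h k l P cx cy cz G).1 (ratPoly3 S q)) : ℚ) *
      ((((dx.1 0).hi : ℤ) : ℚ) / ω.T) * ((((dy.1 0).hi : ℤ) : ℚ) / ω.T) * ((((dz.1 0).hi : ℤ) : ℚ) / ω.T))
    have hceilR := (Rat.cast_le (K := ℝ)).2 hceil
    push_cast at hceilR
    exact hceilR
  · -- integrability of the iterated inner integral on `[x0, x1]`
    have h1 := hI.comp_sub_right (cx : ℝ)
    have ea : -(h : ℝ) + (cx : ℝ) = (B.x0 : ℝ) := by rw [← ex0]; ring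
    have eb : (h : ℝ) + (cx : ℝ) = (B.x1 : ℝ) := by rw [← ex1]; ring
    rw [ea, eb] at h1
    refine h1.congr fun x hx' => ?_
    rw [uIoc_of_le hxx] at hx'
    show (∫ v in (-(k : ℝ))..k, ∫ w in (-(l : ℝ))..l, WX (x - cx) * (WY v *
        (WZ w * G.toFun₃ ((cx : ℝ) + (x - cx)) ((cy : ℝ) + v) ((cz : ℝ) + w)))) =
      ∫ y in (B.y0 : ℝ)..B.y1, ∫ z in (B.z0 : ℝ)..B.z1, wfunL3 ω R F x y z
    rw [← e2 x]
    refine intervalIntegral.integral_congr fun y hy' => ?_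
    rw [uIcc_of_le hyy] at hy'
    show (∫ w in (-(l : ℝ))..l, WX (x - cx) * (WY (y - cy) *
        (WZ w * G.toFun₃ ((cx : ℝ) + (x - cx)) ((cy : ℝ) + (y - cy)) ((cz : ℝ) + w)))) =
      ∫ z in (B.z0 : ℝ)..B.z1, wfunL3 ω R F x y z
    rw [← e3 x y]
    refine intervalIntegral.integral_congr fun z hz' => ?_
    rw [uIcc_of_le hzz] at hz'
    exact (hpt x hx'.1.le hx'.2 y hy'.1 hy'.2 z hz'.1 hz'.2).symm
  · -- integrability of the innermost integral on every `x`-section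
    intro x hx0 hx1
    have hu : |x - (cx : ℝ)| ≤ h := by
      rw [abs_le]; constructor <;> linarith [ex0, ex1]
    have h1 := (hσ (x - cx) hu).comp_sub_right (cy : ℝ)
    have ea : -(k : ℝ) + (cy : ℝ) = (B.y0 : ℝ) := by rw [← ey0]; ring
    have eb : (k : ℝ) + (cy : ℝ) = (B.y1 : ℝ) := by rw [← ey1]; ring
    rw [ea, eb] at h1
    refine h1.congr fun y hy' => ?_
    rw [uIoc_of_le hyy] at hy'
    show (∫ w in (-(l : ℝ))..l, WX (x - cx) * (WY (y - cy) * (WZ w * G.toFun₃ ((cx : ℝ) + (x - cx))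
        ((cy : ℝ) + (y - cy)) ((cz : ℝ) + w)))) = ∫ z in (B.z0 : ℝ)..B.z1, wfunL3 ω R F x y z
    rw [← e3 x y]
    refine intervalIntegral.integral_congr fun z hz' => ?_
    rw [uIcc_of_le hzz] at hz'
    exact (hpt x hx0 hx1 y hy'.1.le hy'.2 z hz'.1 hz'.2).symm
  · -- integrability of every section
    intro x y hx0 hx1 hy0 hy1
    have hu : |x - (cx : ℝ)| ≤ h := by
      rw [abs_le]; constructor <;> linarith [ex0, ex1]
    have hv : |y - (cy : ℝ)| ≤ k := by
      rw [abs_le]; constructor <;> linarith [ey0, ey1]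
    have h1 := (hτ (x - cx) (y - cy) hu hv).comp_sub_right (cz : ℝ)
    have ea : -(l : ℝ) + (cz : ℝ) = (B.z0 : ℝ) := by rw [← ez0]; ring
    have eb : (l : ℝ) + (cz : ℝ) = (B.z1 : ℝ) := by rw [← ez1]; ring
    rw [ea, eb] at h1
    refine h1.congr fun z hz' => ?_
    rw [uIoc_of_le hzz] at hz'
    show WX (x - cx) * (WY (y - cy) * (WZ (z - cz) * G.toFun₃ ((cx : ℝ) + (x - cx)) ((cy : ℝ) + (y - cy))
        ((cz : ℝ) + (z - cz)))) = wfunL3 ω R F x y z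
    rw [add_sub_cancel, add_sub_cancel, add_sub_cancel]
    exact (hpt x hx0 hx1 y hy0 hy1 z hz'.1.le hz'.2).symm

/-! ### Part 4. The certificate, its soundness, and a refinement heuristic -/

/-- **Kernel obligation for leaf `i` of the face-weighted 3-D certificate** (one `decide` per leaf): root box `R`,
weight descriptor `ω`, regular part `F`. [cite: DavisRabinowitz1984, Sect. 2.12.6]
[cite: MahboubiMelquiondSibutpinote2016, Sect. 3.3] -/
def leafCheckWL3 (S : ℕ) (F : BExpr3T) (ω : WLPrm3) (R : Box3Q) (t : KdTree3) (i : ℕ) : Bool :=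
  leafCheck3R (leafEnclWL3 S F ω R) t R i

/-- Final obligation (`= treeCheckG3`: positivity of `S`, leaf count, `Σ claims ⊆ [lo·S, hi·S]`).
[cite: MahboubiMelquiondSibutpinote2016, Sect. 3.3] -/
def treeCheckWL3 (S : ℕ) (t : KdTree3) (n : ℕ) (lo hi : ℚ) : Bool := treeCheckG3 S t n lo hi

/-- **Soundness of the face-weighted adaptive 3-D certificate** (no side hypotheses): if every leaf obligation and the
final obligation hold, then `lo ≤ ∫_{x0}^{x1} ∫_{y0}^{y1} ∫_{z0}^{z1} w_x(x) · (w_y(y) · (w_z(z) · F(x, y, z))) dz dy dx ≤ hi`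
with `w_x(x) = (x − x0)^{xl} (−log(x − x0))^{kxl} · ((x1 − x)^{xr} (−log(x1 − x))^{kxr})`, `w_y`, `w_z` likewise —
integrable algebraic, logarithmic and mixed face, edge and corner singularities of tensor form included.
[cite: DavisRabinowitz1984, Sect. 2.12.6] [cite: DavisRabinowitz1984, Sect. 5.6] [cite: MakinoBerz2003, Algorithm 2]
[cite: MahboubiMelquiondSibutpinote2016, Sect. 3.3] -/
theorem integral_bounds_of_leafCheckWL3 {S : ℕ} {F : BExpr3T} {ω : WLPrm3} {R : Box3Q} {t : KdTree3} {n : ℕ}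
    {lo hi : ℚ} (hleaf : ∀ i : ℕ, i < n → leafCheckWL3 S F ω R t i = true)
    (ht : treeCheckWL3 S t n lo hi = true) :
    (lo : ℝ) ≤ ∫ x in (R.x0 : ℝ)..R.x1, ∫ y in (R.y0 : ℝ)..R.y1, ∫ z in (R.z0 : ℝ)..R.z1,
        (x - R.x0) ^ (ω.xl : ℝ) * (-Real.log (x - R.x0)) ^ ω.kxl *
            (((R.x1 : ℝ) - x) ^ (ω.xr : ℝ) * (-Real.log ((R.x1 : ℝ) - x)) ^ ω.kxr) *
          ((y - R.y0) ^ (ω.yl : ℝ) * (-Real.log (y - R.y0)) ^ ω.kyl *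
              (((R.y1 : ℝ) - y) ^ (ω.yr : ℝ) * (-Real.log ((R.y1 : ℝ) - y)) ^ ω.kyr) *
            ((z - R.z0) ^ (ω.zl : ℝ) * (-Real.log (z - R.z0)) ^ ω.kzl *
                (((R.z1 : ℝ) - z) ^ (ω.zr : ℝ) * (-Real.log ((R.z1 : ℝ) - z)) ^ ω.kzr) * F.toFun₃ x y z)) ∧
      ∫ x in (R.x0 : ℝ)..R.x1, ∫ y in (R.y0 : ℝ)..R.y1, ∫ z in (R.z0 : ℝ)..R.z1,
        (x - R.x0) ^ (ω.xl : ℝ) * (-Real.log (x - R.x0)) ^ ω.kxl *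
            (((R.x1 : ℝ) - x) ^ (ω.xr : ℝ) * (-Real.log ((R.x1 : ℝ) - x)) ^ ω.kxr) *
          ((y - R.y0) ^ (ω.yl : ℝ) * (-Real.log (y - R.y0)) ^ ω.kyl *
              (((R.y1 : ℝ) - y) ^ (ω.yr : ℝ) * (-Real.log ((R.y1 : ℝ) - y)) ^ ω.kyr) *
            ((z - R.z0) ^ (ω.zl : ℝ) * (-Real.log (z - R.z0)) ^ ω.kzl *
                (((R.z1 : ℝ) - z) ^ (ω.zr : ℝ) * (-Real.log ((R.z1 : ℝ) - z)) ^ ω.kzr) * F.toFun₃ x y z)) ≤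
        (hi : ℝ) :=
  integral_bounds_of_leafCheck3R (f := wfunL3 ω R F) (Λ := leafEnclWL3 S F ω R)
    (fun hS B P hok => leafEnclWL3_sound hS F ω R B P hok) hleaf ht

/-- **Refinement heuristic for the face-weighted 3-D certificate**: a leaf whose enclosure is rejected or wider than
`tol` (scaled by `S`) is split, at most `depth` deep — first in a direction whose moments are rejected, else along the
longest side — at the cut `cutW` of the bivariate algebraic module (power witnesses of the algebraic exponents;
midpoints otherwise).  A PROPOSAL, certified leaf by leaf by `leafCheckWL3`. [cite: MahboubiMelquiondSibutpinote2016, Sect. 3.3] -/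
def kdRefineWL3 (S : ℕ) (F : BExpr3T) (ω : WLPrm3) (R : Box3Q) (P : EPrm) (tol : ℤ) : ℕ → Box3Q → KdTree3
  | 0, B => KdTree3.leaf P (leafEnclWL3 S F ω R B P).1
  | d + 1, B =>
      let e := leafEnclWL3 S F ω R B P
      if e.2 && decide (e.1.hi - e.1.lo ≤ tol) then KdTree3.leaf P e.1
      else
        let h := (B.x1 - B.x0) / 2
        let k := (B.y1 - B.y0) / 2
        let l := (B.z1 - B.z0) / 2
        let px := dirPlanL ω.T ω.KL h (B.x0 - R.x0) (R.x1 - B.x1) ω.xl ω.xr ω.kxl ω.kxr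
        let py := dirPlanL ω.T ω.KL k (B.y0 - R.y0) (R.y1 - B.y1) ω.yl ω.yr ω.kyl ω.kyr
        let pz := dirPlanL ω.T ω.KL l (B.z0 - R.z0) (R.z1 - B.z1) ω.zl ω.zr ω.kzl ω.kzr
        let dx := dirMomL ω.T ω.KL h (B.x0 - R.x0) (R.x1 - B.x1) ω.xl ω.xr ω.kxl ω.kxr px.1 px.2
        let dy := dirMomL ω.T ω.KL k (B.y0 - R.y0) (R.y1 - B.y1) ω.yl ω.yr ω.kyl ω.kyr py.1 py.2
        let dz := dirMomL ω.T ω.KL l (B.z0 - R.z0) (R.z1 - B.z1) ω.zl ω.zr ω.kzl ω.kzr pz.1 pz.2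
        let wx := B.x1 - B.x0
        let wy := B.y1 - B.y0
        let wz := B.z1 - B.z0
        let dir : ℕ :=
          if !dx.2 then 0 else if !dy.2 then 1 else if !dz.2 then 2
          else if wy ≤ wx ∧ wz ≤ wx then 0 else if wz ≤ wy then 1 else 2
        if dir = 0 then
          let c := cutW B.x0 B.x1 R.x0 R.x1 ω.xl ω.xr
          KdTree3.splitX c (kdRefineWL3 S F ω R P tol d ⟨B.x0, c, B.y0, B.y1, B.z0, B.z1⟩)
            (kdRefineWL3 S F ω R P tol d ⟨c, B.x1, B.y0, B.y1, B.z0, B.z1⟩)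
        else if dir = 1 then
          let c := cutW B.y0 B.y1 R.y0 R.y1 ω.yl ω.yr
          KdTree3.splitY c (kdRefineWL3 S F ω R P tol d ⟨B.x0, B.x1, B.y0, c, B.z0, B.z1⟩)
            (kdRefineWL3 S F ω R P tol d ⟨B.x0, B.x1, c, B.y1, B.z0, B.z1⟩)
        else
          let c := cutW B.z0 B.z1 R.z0 R.z1 ω.zl ω.zr
          KdTree3.splitZ c (kdRefineWL3 S F ω R P tol d ⟨B.x0, B.x1, B.y0, B.y1, B.z0, c⟩)
            (kdRefineWL3 S F ω R P tol d ⟨B.x0, B.x1, B.y0, B.y1, c, B.z1⟩)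

end PolyMP

end Literature.Analysis.ValidatedNumerics
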